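import Summits.ResolutionOfSingularities.ResolutionOfSingularities.Theorems.FrobeniusLadderFRationalResolutionDiagonalizableQuotientPerfect
import Summits.ResolutionOfSingularities.ResolutionOfSingularities.Theorems.FrobeniusLadderFRationalResolutionDiagQuotientDimLeThreeOfPrint
import Mathlib.FieldTheory.Perfect
import HarnessLib

/-!
# Crux `FrobeniusLadder.FRationalResolution` (stmt-ResolutionOfSingularities-15317), line `redirect`,
# stub `stub_diagonalizableQuotientResolution` — THE STUB = TWO PRINTS ∧ ONE RESIDUE (re-registration template,
# leafhand-4 g4 census MEMO-leafhand4-g4 §4.2)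

The registered stub (any field `k`, any characteristic; étale regular `A`-graded quotient charts ⇒ `Scheme.HasResolution X`)
is, by name and signature, the conjunction of

* the named fact `BerghRydh2019_diagonalizableQuotientResolution` (Bergh–Rydh 2019 Thm. 5, diagonalizable case; every
  PERFECT field, in particular every field of characteristic `0` and every finite field) — tree:
  `diagonalizableQuotientResolution_of_perfectField` (p153668, regular = smooth over a perfect field);
* the named fact `CossartPiltant2019General` (CP 2019 Thm. 1.1; every field, `dim X ≤ 3`) — tree:
  `DiagQuotientDimLeThreeOfPrint.stub_diagonalizableQuotientResolution_of_cossartPiltant2019General_of_dim_le_three` (p829200),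
  a print the route ALREADY consumes in crux 15315's `stub_namedFacts`;
* ONE residue beyond every print: IMPERFECT ground field (hence prime characteristic) and `dim X ≥ 4` (stated below as the
  hypothesis `hres`, binders of the stub verbatim plus `¬ PerfectField k` and `¬ topologicalKrullDim X ≤ 3`).

`stub_diagonalizableQuotientResolution_of_twoPrints_of_imperfectResidue` assembles the stub's statement VERBATIM from these three
inputs (case split: perfect / dimension `≤ 3` / residue; an imperfect field has prime characteristic because characteristic-`0`
fields are perfect). This is the exact shape in which a planner can re-register the line's endgame stub as
«named facts ∧ residue», as crux 15315's skeleton `step_door` v41.1 does with its prints. CONDITIONAL on the two named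
facts (hypotheses `hBR`, `hCP`); no stub is closed by name. No definitions, no new named facts, no sorry.
[cite: BerghRydh2019, Thm 5 (arXiv:1905.00872, p. 4)] [cite: CossartPiltant2019, Thm. 1.1]
-/

noncomputable section

-- single-problem summit: the doubled namespace component is forced
set_option linter.dupNamespace false

open CategoryTheory AlgebraicGeometry
open Literature.AlgebraicGeometry.Resolution

namespace Summit.ResolutionOfSingularities.ResolutionOfSingularities.Theorems.FRationalResolution.DiagQuotientPrintResidueSplit

/-- **An imperfect field has prime characteristic** (fields of characteristic `0` are perfect). [folklore] -/
theorem exists_prime_charP_of_not_perfectField (k : Type) [Field k] (hk : ¬ PerfectField k) :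
    ∃ p : ℕ, p.Prime ∧ CharP k p := by
  obtain ⟨p, hp⟩ := CharP.exists k
  rcases CharP.char_is_prime_or_zero k p with h | h
  · exact ⟨p, h, hp⟩
  · subst h
    haveI : CharZero k := CharP.charP_to_charZero k
    exact absurd (inferInstance : PerfectField k) hk

/-- **`stub_diagonalizableQuotientResolution` ⟸ Bergh–Rydh 2019 Thm. 5 ∧ Cossart–Piltant 2019 Thm. 1.1 ∧ the imperfect-field,
dimension-`≥ 4` residue** — the stub's binders VERBATIM in the conclusion. The residue hypothesis `hres` is the stub restricted to
imperfect ground fields of (necessarily prime) characteristic `p` and `¬ topologicalKrullDim X ≤ 3`; everything else is print.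
[cite: BerghRydh2019, Thm 5 (arXiv:1905.00872, p. 4)] [cite: CossartPiltant2019, Thm. 1.1] -/
theorem stub_diagonalizableQuotientResolution_of_twoPrints_of_imperfectResidue
    (hBR : BerghRydh2019_diagonalizableQuotientResolution) (hCP : CossartPiltant2019General.{0})
    (hres : ∀ (p : ℕ), p.Prime → ∀ (k : Type) [Field k] [CharP k p], ¬ PerfectField k →
      ∀ (X : Scheme.{0}) (g : X ⟶ Spec (.of k)) [IsIntegral X] [IsSeparated g] [LocallyOfFiniteType g]
        [QuasiCompact g],
        (∀ x : X, ∃ (A : Type) (_ : AddCommGroup A) (_ : Finite A) (_ : DecidableEq A)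
          (S : Type) (_ : CommRing S) (_ : Algebra k S) (𝒮 : A → Submodule k S)
          (_ : GradedAlgebra 𝒮), Algebra.FiniteType k S ∧ IsRegularRing S ∧
          ∃ φ : Spec (.of (𝒮 0)) ⟶ X, Etale φ ∧ x ∈ Set.range φ ∧
            φ ≫ g = Spec.map (CommRingCat.ofHom (algebraMap k (𝒮 0)))) →
        ¬ topologicalKrullDim X ≤ 3 → Scheme.HasResolution X)
    (k : Type) [Field k] (X : Scheme.{0}) (g : X ⟶ Spec (.of k))
    [IsIntegral X] [IsSeparated g] [LocallyOfFiniteType g] [QuasiCompact g]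
    (hq : ∀ x : X, ∃ (A : Type) (_ : AddCommGroup A) (_ : Finite A) (_ : DecidableEq A)
        (S : Type) (_ : CommRing S) (_ : Algebra k S) (𝒮 : A → Submodule k S)
        (_ : GradedAlgebra 𝒮), Algebra.FiniteType k S ∧ IsRegularRing S ∧
        ∃ φ : Spec (.of (𝒮 0)) ⟶ X, Etale φ ∧ x ∈ Set.range φ ∧
          φ ≫ g = Spec.map (CommRingCat.ofHom (algebraMap k (𝒮 0)))) :
    Scheme.HasResolution X := by
  by_cases hk : PerfectField k
  · exact diagonalizableQuotientResolution_of_perfectField hBR k X g hq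
  by_cases hdim : topologicalKrullDim X ≤ 3
  · exact DiagQuotientDimLeThreeOfPrint.stub_diagonalizableQuotientResolution_of_cossartPiltant2019General_of_dim_le_three
      hCP k X g hq hdim
  obtain ⟨p, hp, hchar⟩ := exists_prime_charP_of_not_perfectField k hk
  exact hres p hp k hk X g hq hdim

/-- **The residue is void over finite fields and in characteristic `0`** (both perfect): there the stub is the Bergh–Rydh print
alone. Recorded as the perfect-field case with the instances found by type-class inference. [folklore] -/
theorem stub_diagonalizableQuotientResolution_of_berghRydh_of_charZero
    (hBR : BerghRydh2019_diagonalizableQuotientResolution)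
    (k : Type) [Field k] [CharZero k] (X : Scheme.{0}) (g : X ⟶ Spec (.of k))
    [IsIntegral X] [IsSeparated g] [LocallyOfFiniteType g] [QuasiCompact g]
    (hq : ∀ x : X, ∃ (A : Type) (_ : AddCommGroup A) (_ : Finite A) (_ : DecidableEq A)
        (S : Type) (_ : CommRing S) (_ : Algebra k S) (𝒮 : A → Submodule k S)
        (_ : GradedAlgebra 𝒮), Algebra.FiniteType k S ∧ IsRegularRing S ∧
        ∃ φ : Spec (.of (𝒮 0)) ⟶ X, Etale φ ∧ x ∈ Set.range φ ∧
          φ ≫ g = Spec.map (CommRingCat.ofHom (algebraMap k (𝒮 0)))) :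
    Scheme.HasResolution X :=
  diagonalizableQuotientResolution_of_perfectField hBR k X g hq

end Summit.ResolutionOfSingularities.ResolutionOfSingularities.Theorems.FRationalResolution.DiagQuotientPrintResidueSplit

end
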